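import Literature.Computability.AlgebraicComplexity.BLMW11KroneckerApproximation
import Literature.NumberTheory.DiophantineGeometry.KroneckerPointSets
import Literature.NumberTheory.DiophantineGeometry.StandardTableauxDichotomy
import Literature.Computability.AlgebraicComplexity.QuantumFunctionalsUpperKroneckerEntropyProofs
import HarnessLib

/-!
# BLMW 2011 §8.1 / §8.3 "Constraints" PROVED: the first-row inequality `|π̄| ≤ |μ̄| + |ν̄|` and
# Manivel's inequalities `|π|_{>ab} ≤ |μ|_{>a} + |ν|_{>b}` for non-vanishing Kronecker coefficients

Sibling proofs file (D-0014; theorems only — no definition, no statement of the tree is changed,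
no named fact is introduced) of `BLMW11KroneckerApproximation.lean` (P. Bürgisser,
J. M. Landsberg, L. Manivel, J. Weyman, SIAM J. Comput. 40 (2011) = arXiv:0907.2850v2, §8
"Kronecker coefficients"; cell `val-lit`, DAG row BLMW11-B). It DISCHARGES the named fact
`BLMW2011_kronecker_firstRow` (§8.1: "if `k_{πμν} ≠ 0`, then `|π̄| ≤ |μ̄| + |ν̄|`", there deduced
from [Brion 1993]) as `BLMW2011_kronecker_firstRow_holds`, and proves the three displayed
"Constraints" of §8.3 (entropy `H(π̃) ≤ 2 log n`; "[Manivel 1997, Théorème 3.2] gives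
`|π|_{>ab} ≤ δ(n-a)⁺ + δ(n-b)⁺`"; "For example `|π|_{≤n} ≥ δ`") for every component `[π]` of
`[(δⁿ)] ⊗ [(δⁿ)]` with `n ≥ 1` (`BLMW2011_rectangular_constraints_of_pos`), which DISCHARGES the
named fact `BLMW2011_rectangular_constraints` (`BLMW2011_rectangular_constraints_holds`). (As first
typed, that fact quantified over all `n : ℕ`; at `n = 0`, `δ ≥ 1` its third conjunct reads `δ ≤ 0`
while the hypothesis holds — all partitions of `0·δ` are empty and `g(∅, ∅, ∅) = 1` — so it was
false as stated; the printed, implicit hypothesis `n = dim V ≥ 1` was then carried into the fact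
as `0 < n →`, which is exactly the form proved here.)

## The proofs (ours; elementary, from the tree's point-set criterion)

Both inequalities are read off the positivity form of the upper bound `k ≤ t` of
Ikenmeyer–Mulmuley–Walter 2017, Lemma 2.3, PROVED in the tree
(`KroneckerPointSets.exists_pointSet_rows_of_kroneckerCoeff_pos`): if `g(μ, ν, π) > 0` then —
writing `g(μ, ν, π) = g(μ, ν, (πᵀ)ᵀ)` — there is an `n`-point SET `P ⊆ ℕ³` whose `x`-slices have
sizes the rows of `μ`, whose `y`-slices have sizes the rows of `ν`, and whose `z`-slices have sizes
the rows of `πᵀ`, i.e. the COLUMN lengths of `π`. In particular every point has `z < π₁`.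

* **First row** (`xMarginal_zero_add_yMarginal_zero_le`). The slices `x = 0` (`μ₁` points) and
  `y = 0` (`ν₁` points) meet in points `(0, 0, z)` with pairwise distinct `z < π₁`, so
  `μ₁ + ν₁ = |x=0 ∪ y=0| + |x=0 ∩ y=0| ≤ n + π₁`, which is `|π̄| ≤ |μ̄| + |ν̄|`
  (`|π̄| = n - π₁`). (BLMW deduce it from Brion's formula; Murnaghan's and Brion's theorems are
  not in the tree.)
* **Manivel's inequalities** (`sum_zMarginal_tsub_le`, then
  `sum_drop_mul_le_of_kroneckerCoeff_ne_zero`). In the slice `z = l` the points have pairwise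
  distinct `(x, y)`, so at most `ab` of them have `x < a ∧ y < b`; hence
  `Σ_l (πᵀ_l - ab)⁺ ≤ #{x ≥ a} + #{y ≥ b} = |μ|_{>a} + |ν|_{>b}`, and `Σ_l (πᵀ_l - ab)⁺` is the
  number of boxes of `π` below row `ab`, i.e. `|π|_{>ab}` (`sum_drop_sortedParts_eq_sum_colLen_tsub`,
  a row/column double count of the Young diagram). This is the general three-partition form; for
  `μ = ν = δⁿ` (the tree's `Nat.Partition.rectangle n δ`, `n` parts equal to `δ`) it is the
  printed `|π|_{>ab} ≤ δ(n-a)⁺ + δ(n-b)⁺`, and `a = 1, b = n` gives `|π|_{≤n} ≥ δ` for `n ≥ 1`.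
* **Entropy.** `H(π̃) ≤ H(μ̃) + H(ν̃)` is the tree's DISCHARGED fact
  `ChristandlVranaZuiddam2023_entropy_le_of_kroneckerCoeff_holds` ((8.2.2) of BLMW), and
  `H(δⁿ normalised) ≤ log₂ n` is `partitionEntropy_le_log_card` (BLMW's `log` read in bits, as
  the typed statement does).

Honest framing: bookkeeping of published inequalities; `VP ≠ VNP` is NOT proved and nothing here
is progress on it.

## References

* [BurgisserEtAl2011] P. Bürgisser, J. M. Landsberg, L. Manivel, J. Weyman, *An overview of
  mathematical issues arising in the geometric complexity theory approach to VP ≠ VNP*, SIAM J.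
  Comput. 40 (2011) 1179–1209 = arXiv:0907.2850v2, §8.1 (first-row inequality), §8.3
  "Constraints" (held text `HOME/lit/pdftxt/BLMW2011` p. 18, p. 22).
* [IkenmeyerMulmuleyWalter2017] C. Ikenmeyer, K. D. Mulmuley, M. Walter, *On vanishing of
  Kronecker coefficients*, Comput. Complexity 26 (2017), Lemma 2.3 (point sets with prescribed
  marginals; the tree's `KroneckerPointSets.lean`).
* [ChristandlVranaZuiddam2023] M. Christandl, P. Vrana, J. Zuiddam, J. Amer. Math. Soc. 36
  (2023), Lemma 3.10.1 (entropy inequality; the tree's `QuantumFunctionalsUpperKronecker*.lean`).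

## Mathlib and tree

Mathlib: `Finset.card_union_add_card_inter`, `Finset.card_le_card_of_injOn`,
`Finset.card_eq_sum_card_fiberwise`, `Finset.sum_le_sum`, `Finset.card_filter_add_card_filter_not`,
`YoungDiagram.mem_iff_lt_rowLen`, `YoungDiagram.mem_iff_lt_colLen`, `YoungDiagram.rowLen_eq_card`,
`List.sum_take_add_sum_drop`, `Real.log_le_log`, `Real.log_natCast_nonneg`. Tree:
`exists_pointSet_rows_of_kroneckerCoeff_pos`, `Nat.Partition.transpose_transpose`,
`getD_sortedParts_transpose`, `getD_sortedParts_le`, `rowLen_youngDiagram`,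
`sup_parts_eq_rowLen_zero`, `Nat.Partition.sortedParts_rectangle`,
`Nat.Partition.card_parts_rectangle_le`, `Nat.Partition.sum_sortedParts`,
`Nat.Partition.length_sortedParts`, `kroneckerCoeff_pos_of_size_zero`,
`ChristandlVranaZuiddam2023_entropy_le_of_kroneckerCoeff_holds`, `partitionEntropy_le_log_card`.
-/

open scoped BigOperators

namespace Literature.Computability.AlgebraicComplexity

open Literature.NumberTheory.DiophantineGeometry
open Literature.Combinatorics.Enumerative.Tomography

/-! ### 1. Counting lemmas for finite point sets in `ℕ³` -/

section PointSets

/-- **First-row count.** If every point of `P ⊆ ℕ³` has third coordinate `< L`, then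
`|{x = 0}| + |{y = 0}| ≤ |P| + L`: the two slices meet in points `(0, 0, z)` with pairwise
distinct `z < L`. [folklore] -/
private theorem xMarginal_zero_add_yMarginal_zero_le (P : Finset (ℕ × ℕ × ℕ)) {L : ℕ}
    (hL : ∀ p ∈ P, p.2.2 < L) : xMarginal P 0 + yMarginal P 0 ≤ P.card + L := by
  classical
  set A := P.filter fun p => p.1 = 0 with hA
  set B := P.filter fun p => p.2.1 = 0 with hB
  have hAB : (A ∪ B).card + (A ∩ B).card = A.card + B.card := Finset.card_union_add_card_inter A B
  have hU : (A ∪ B).card ≤ P.card :=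
    Finset.card_le_card (Finset.union_subset (Finset.filter_subset _ _) (Finset.filter_subset _ _))
  have hI : (A ∩ B).card ≤ L := by
    calc (A ∩ B).card ≤ (Finset.range L).card := by
          refine Finset.card_le_card_of_injOn (fun p => p.2.2) ?_ ?_
          · intro p hp
            rw [Finset.mem_coe, Finset.mem_inter, Finset.mem_filter] at hp
            exact Finset.mem_coe.2 (Finset.mem_range.2 (hL p hp.1.1))
          · intro p hp q hq hpq
            rw [Finset.mem_coe, Finset.mem_inter, Finset.mem_filter, Finset.mem_filter] at hp hq
            refine Prod.ext (hp.1.2.trans hq.1.2.symm) (Prod.ext (hp.2.2.trans hq.2.2.symm) ?_)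
            exact hpq
      _ = L := Finset.card_range L
  change A.card + B.card ≤ P.card + L
  omega

/-- **Slice count.** In the slice `z = l` of a point set the points have pairwise distinct
`(x, y)`, so at most `a * b` of them satisfy `x < a ∧ y < b`; hence
`zMarginal P l - ab ≤ #{p ∈ P : p_z = l, a ≤ p_x ∨ b ≤ p_y}` (truncated subtraction). [folklore] -/
private theorem zMarginal_tsub_le (P : Finset (ℕ × ℕ × ℕ)) (a b l : ℕ) :
    zMarginal P l - a * b ≤
      ((P.filter fun p => ¬ (p.1 < a ∧ p.2.1 < b)).filter fun p => p.2.2 = l).card := by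
  classical
  set S := P.filter fun p => p.2.2 = l with hS
  have hsplit : (S.filter fun p => p.1 < a ∧ p.2.1 < b).card +
      (S.filter fun p => ¬ (p.1 < a ∧ p.2.1 < b)).card = S.card :=
    Finset.card_filter_add_card_filter_not _
  have hsmall : (S.filter fun p => p.1 < a ∧ p.2.1 < b).card ≤ a * b := by
    calc (S.filter fun p => p.1 < a ∧ p.2.1 < b).card
          ≤ (Finset.range a ×ˢ Finset.range b).card := by
          refine Finset.card_le_card_of_injOn (fun p => (p.1, p.2.1)) ?_ ?_
          · intro p hp
            rw [Finset.mem_coe, Finset.mem_filter] at hp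
            rw [Finset.mem_coe, Finset.mem_product, Finset.mem_range, Finset.mem_range]
            exact hp.2
          · intro p hp q hq hpq
            rw [Finset.mem_coe, Finset.mem_filter, Finset.mem_filter] at hp hq
            simp only [Prod.mk.injEq] at hpq
            exact Prod.ext hpq.1 (Prod.ext hpq.2 (hp.1.2.trans hq.1.2.symm))
      _ = a * b := by rw [Finset.card_product, Finset.card_range, Finset.card_range]
  have heq : ((P.filter fun p => ¬ (p.1 < a ∧ p.2.1 < b)).filter fun p => p.2.2 = l) =
      (S.filter fun p => ¬ (p.1 < a ∧ p.2.1 < b)) := by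
    rw [hS, Finset.filter_filter, Finset.filter_filter]
    exact Finset.filter_congr fun p _ => and_comm
  rw [heq]
  have hz : zMarginal P l = S.card := rfl
  rw [hz]
  omega

/-- **Manivel's count.** For a point set `P ⊆ ℕ³` with all third coordinates `< L`:
`Σ_{l < L} (zMarginal P l - ab) ≤ #{p : a ≤ p_x} + #{p : b ≤ p_y}`. [folklore] -/
private theorem sum_zMarginal_tsub_le (P : Finset (ℕ × ℕ × ℕ)) (a b : ℕ) {L : ℕ}
    (hL : ∀ p ∈ P, p.2.2 < L) :
    ∑ l ∈ Finset.range L, (zMarginal P l - a * b) ≤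
      (P.filter fun p => a ≤ p.1).card + (P.filter fun p => b ≤ p.2.1).card := by
  classical
  set Big := P.filter fun p => ¬ (p.1 < a ∧ p.2.1 < b) with hBig
  have h1 : ∑ l ∈ Finset.range L, (zMarginal P l - a * b) ≤
      ∑ l ∈ Finset.range L, (Big.filter fun p => p.2.2 = l).card :=
    Finset.sum_le_sum fun l _ => zMarginal_tsub_le P a b l
  have h2 : ∑ l ∈ Finset.range L, (Big.filter fun p => p.2.2 = l).card = Big.card :=
    (Finset.card_eq_sum_card_fiberwise (f := fun p : ℕ × ℕ × ℕ => p.2.2) fun p hp =>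
      Finset.mem_range.2 (hL p (Finset.mem_of_mem_filter _ hp))).symm
  have h3 : Big.card ≤ (P.filter fun p => a ≤ p.1).card + (P.filter fun p => b ≤ p.2.1).card := by
    calc Big.card ≤ ((P.filter fun p => a ≤ p.1) ∪ (P.filter fun p => b ≤ p.2.1)).card := by
          refine Finset.card_le_card fun p hp => ?_
          rw [hBig, Finset.mem_filter] at hp
          rw [Finset.mem_union, Finset.mem_filter, Finset.mem_filter]
          by_cases ha : p.1 < a
          · right; exact ⟨hp.1, not_lt.1 fun hb => hp.2 ⟨ha, hb⟩⟩
          · left; exact ⟨hp.1, not_lt.1 ha⟩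
      _ ≤ _ := Finset.card_union_le _ _
  omega

/-- The number of points with `x < a` is `Σ_{i < a}` of the `x`-marginals. [folklore] -/
private theorem card_filter_fst_lt_eq_sum_xMarginal (P : Finset (ℕ × ℕ × ℕ)) (a : ℕ) :
    (P.filter fun p => p.1 < a).card = ∑ i ∈ Finset.range a, xMarginal P i := by
  classical
  rw [Finset.card_eq_sum_card_fiberwise (f := fun p : ℕ × ℕ × ℕ => p.1) (t := Finset.range a)
    fun p hp => Finset.mem_range.2 (Finset.mem_filter.1 hp).2]
  refine Finset.sum_congr rfl fun i hi => ?_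
  rw [xMarginal, Finset.filter_filter]
  congr 1
  refine Finset.filter_congr fun p _ => ?_
  constructor
  · exact fun h => h.2
  · intro h
    refine ⟨?_, h⟩
    show p.1 < a
    rw [h]
    exact Finset.mem_range.1 hi

/-- The number of points with `y < b` is `Σ_{j < b}` of the `y`-marginals. [folklore] -/
private theorem card_filter_snd_lt_eq_sum_yMarginal (P : Finset (ℕ × ℕ × ℕ)) (b : ℕ) :
    (P.filter fun p => p.2.1 < b).card = ∑ j ∈ Finset.range b, yMarginal P j := by
  classical
  rw [Finset.card_eq_sum_card_fiberwise (f := fun p : ℕ × ℕ × ℕ => p.2.1) (t := Finset.range b)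
    fun p hp => Finset.mem_range.2 (Finset.mem_filter.1 hp).2]
  refine Finset.sum_congr rfl fun j hj => ?_
  rw [yMarginal, Finset.filter_filter]
  congr 1
  refine Finset.filter_congr fun p _ => ?_
  constructor
  · exact fun h => h.2
  · intro h
    refine ⟨?_, h⟩
    show p.2.1 < b
    rw [h]
    exact Finset.mem_range.1 hj

end PointSets

/-! ### 2. Partition bookkeeping: rows below row `c`, by rows and by columns -/

section Partitions

variable {N : ℕ}

/-- `(l.drop c).sum = Σ_{i < R} [c ≤ i] · l_i` for any `R ≥ |l|` (zero-padded entries).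
[folklore] -/
private theorem sum_drop_eq_sum_range_ite (l : List ℕ) (c : ℕ) {R : ℕ} (hR : l.length ≤ R) :
    (l.drop c).sum = ∑ i ∈ Finset.range R, (if c ≤ i then l.getD i 0 else 0) := by
  induction l generalizing c R with
  | nil => simp
  | cons x t ih =>
    obtain ⟨R', rfl⟩ : ∃ R', R = R' + 1 := ⟨R - 1, by simp only [List.length_cons] at hR; omega⟩
    have hR' : t.length ≤ R' := by simp only [List.length_cons] at hR; omega
    rw [Finset.sum_range_succ']
    cases c with
    | zero =>
      have h0 := ih 0 hR'
      simp only [List.drop_zero, zero_le, if_true] at h0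
      simp only [List.drop_zero, List.sum_cons, zero_le, if_true, List.getD_cons_succ,
        List.getD_cons_zero, h0]
      ring
    | succ c =>
      simp only [List.drop_succ_cons, List.getD_cons_succ, List.getD_cons_zero,
        Nat.succ_le_succ_iff, Nat.le_zero, Nat.succ_ne_zero, if_false, add_zero]
      exact ih c hR'

/-- A box of the Young diagram of `π ⊢ N` has both coordinates `< N`. [folklore] -/
private theorem fst_lt_and_snd_lt_of_mem_youngDiagram (π : Nat.Partition N) {x : ℕ × ℕ}
    (hx : x ∈ π.youngDiagram) : x.1 < N ∧ x.2 < N := by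
  have h1 : x.2 < π.youngDiagram.rowLen x.1 := YoungDiagram.mem_iff_lt_rowLen.1 hx
  have h2 : x.1 < π.youngDiagram.colLen x.2 := YoungDiagram.mem_iff_lt_colLen.1 hx
  rw [rowLen_youngDiagram] at h1
  rw [← getD_sortedParts_transpose] at h2
  exact ⟨lt_of_lt_of_le h2 (getD_sortedParts_le _ _), lt_of_lt_of_le h1 (getD_sortedParts_le _ _)⟩

/-- **Rows below row `c`, counted by rows and by columns**: for `π ⊢ N`,
`Σ_{i ≥ c} π_i = Σ_{l < N} (πᵀ_l - c)` — both count the boxes of the Young diagram of `π` in rows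
`≥ c` (`πᵀ_l` = the length of column `l`). [folklore] -/
private theorem sum_drop_sortedParts_eq_sum_colLen_tsub (π : Nat.Partition N) (c : ℕ) :
    (π.sortedParts.drop c).sum = ∑ l ∈ Finset.range N, (π.youngDiagram.colLen l - c) := by
  classical
  set S := π.youngDiagram.cells.filter fun x => c ≤ x.1
  -- by rows
  have hrows : S.card = (π.sortedParts.drop c).sum := by
    rw [Finset.card_eq_sum_card_fiberwise (f := fun x : ℕ × ℕ => x.1) (t := Finset.range N)
      fun x hx => Finset.mem_range.2
        (fst_lt_and_snd_lt_of_mem_youngDiagram π (Finset.mem_filter.1 hx).1).1]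
    rw [sum_drop_eq_sum_range_ite π.sortedParts c (R := N)
      (by rw [Nat.Partition.length_sortedParts]; exact π.card_parts_le_size)]
    refine Finset.sum_congr rfl fun i _ => ?_
    split_ifs with hci
    · rw [← rowLen_youngDiagram, YoungDiagram.rowLen_eq_card]
      congr 1
      ext x
      simp only [Finset.mem_filter, YoungDiagram.mem_row_iff, YoungDiagram.mem_cells]
      constructor
      · rintro ⟨⟨hx, _⟩, rfl⟩; exact ⟨hx, rfl⟩
      · rintro ⟨hx, rfl⟩; exact ⟨⟨hx, hci⟩, rfl⟩
    · rw [Finset.card_eq_zero, Finset.filter_eq_empty_iff]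
      intro x hx hxi
      simp only [Finset.mem_filter] at hx
      exact hci (hxi ▸ hx.2)
  -- by columns
  have hcols : S.card = ∑ l ∈ Finset.range N, (π.youngDiagram.colLen l - c) := by
    rw [Finset.card_eq_sum_card_fiberwise (f := fun x : ℕ × ℕ => x.2) (t := Finset.range N)
      fun x hx => Finset.mem_range.2
        (fst_lt_and_snd_lt_of_mem_youngDiagram π (Finset.mem_filter.1 hx).1).2]
    refine Finset.sum_congr rfl fun l _ => ?_
    rw [← Nat.card_Ico c (π.youngDiagram.colLen l)]
    refine Finset.card_bij (fun x _ => x.1) ?_ ?_ ?_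
    · intro x hx
      simp only [Finset.mem_filter, YoungDiagram.mem_cells] at hx
      obtain ⟨⟨hxY, hcx⟩, hxl⟩ := hx
      rw [Finset.mem_Ico]
      refine ⟨hcx, ?_⟩
      have := YoungDiagram.mem_iff_lt_colLen.1 hxY
      rwa [hxl] at this
    · intro x hx y hy hxy
      simp only [Finset.mem_filter] at hx hy
      exact Prod.ext hxy (hx.2.trans hy.2.symm)
    · intro i hi
      rw [Finset.mem_Ico] at hi
      refine ⟨(i, l), ?_, rfl⟩
      simp only [Finset.mem_filter, YoungDiagram.mem_cells, and_true]
      exact ⟨YoungDiagram.mem_iff_lt_colLen.2 hi.2, hi.1⟩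
  rw [← hrows, hcols]

/-- The first `a` rows of the rectangle `(δ, …, δ)` (`n` parts equal to `δ`) sum to
`min(a, n) · δ`. [folklore] -/
private theorem sum_range_getD_sortedParts_rectangle (n δ a : ℕ) :
    ∑ i ∈ Finset.range a, (Nat.Partition.rectangle n δ).sortedParts.getD i 0 = min a n * δ := by
  rcases Nat.eq_zero_or_pos δ with rfl | hδ
  · rw [Nat.mul_zero (min a n)]
    refine Finset.sum_eq_zero fun i _ => ?_
    have h0 : (Nat.Partition.rectangle n 0).parts.card = 0 := by
      rw [Nat.Partition.parts_rectangle, Multiset.card_eq_zero, Multiset.filter_eq_nil]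
      intro x hx
      rw [Multiset.eq_of_mem_replicate hx]
      exact fun h => h rfl
    exact Complexity.getD_sortedParts_eq_zero _ (by rw [h0]; exact Nat.zero_le _)
  · rw [Nat.Partition.sortedParts_rectangle n δ hδ.ne']
    have key : ∀ i, (List.replicate n δ).getD i 0 = if i < n then δ else 0 := by
      intro i
      split_ifs with hi
      · rw [List.getD_eq_getElem _ _ (by simpa using hi), List.getElem_replicate]
      · rw [List.getD_eq_default _ _ (by simpa using hi)]
    simp_rw [key]
    have hfilter : (Finset.range a).filter (fun i => i < n) = Finset.range (min a n) := by
      ext i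
      simp only [Finset.mem_filter, Finset.mem_range, lt_min_iff]
    rw [Finset.sum_ite, Finset.sum_const_zero, add_zero, Finset.sum_const, smul_eq_mul, hfilter,
      Finset.card_range]

/-- `δ (n - a) + min(a, n) δ = n δ` (truncated subtraction). [folklore] -/
private theorem mul_tsub_add_min_mul (n δ a : ℕ) : δ * (n - a) + min a n * δ = n * δ := by
  rcases le_total a n with h | h
  · rw [min_eq_left h]
    obtain ⟨c, rfl⟩ := Nat.exists_eq_add_of_le h
    rw [Nat.add_sub_cancel_left]
    ring
  · rw [min_eq_right h, Nat.sub_eq_zero_of_le h]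
    ring

/-- `μ₁ = μ.parts.sup` is the first zero-padded row. [folklore] -/
private theorem sup_parts_eq_getD_zero (μ : Nat.Partition N) : μ.parts.sup = μ.sortedParts.getD 0 0 := by
  rw [sup_parts_eq_rowLen_zero, rowLen_youngDiagram]

end Partitions

/-! ### 3. The point set of a non-vanishing Kronecker coefficient, and the two inequalities -/

section Kronecker

variable {N : ℕ}

/-- **IMW's point set, arranged for `g(μ, ν, π) ≠ 0`.** If `g(μ, ν, π) ≠ 0` (the tree's
`kroneckerCoeff ℂ μ ν π`) there is an `N`-point set `P ⊆ ℕ³` whose `x`-slices have the sizes of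
the rows of `μ`, whose `y`-slices have the sizes of the rows of `ν`, whose `z`-slices have the
sizes of the COLUMNS of `π` — and so every point has third coordinate `< π₁`. (The tree's
`exists_pointSet_rows_of_kroneckerCoeff_pos` applied to `g(μ, ν, (πᵀ)ᵀ)`.)
[cite: IkenmeyerMulmuleyWalter2017, Lemma 2.3 (upper bound, positivity form)] -/
theorem exists_pointSet_cols_of_kroneckerCoeff_ne_zero {mu nu pi : Nat.Partition N}
    (h : kroneckerCoeff ℂ mu nu pi ≠ 0) :
    ∃ P : Finset (ℕ × ℕ × ℕ), P.card = N ∧ (∀ i, xMarginal P i = mu.sortedParts.getD i 0) ∧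
      (∀ j, yMarginal P j = nu.sortedParts.getD j 0) ∧
      (∀ l, zMarginal P l = pi.youngDiagram.colLen l) ∧
      ∀ p ∈ P, p.2.2 < pi.sortedParts.getD 0 0 := by
  have h' : 0 < kroneckerCoeff ℂ mu nu pi.transpose.transpose := by
    rw [Nat.Partition.transpose_transpose]
    exact Nat.pos_of_ne_zero h
  obtain ⟨P, hcard, hx, hy, hz⟩ := exists_pointSet_rows_of_kroneckerCoeff_pos ℂ h'
  have hz' : ∀ l, zMarginal P l = pi.youngDiagram.colLen l := fun l => by
    rw [hz l, getD_sortedParts_transpose]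
  refine ⟨P, hcard, hx, hy, hz', fun p hp => ?_⟩
  have h1 : 0 < zMarginal P p.2.2 := Finset.card_pos.2 ⟨p, Finset.mem_filter.2 ⟨hp, rfl⟩⟩
  rw [hz' p.2.2] at h1
  have h2 : ((0 : ℕ), p.2.2) ∈ pi.youngDiagram := YoungDiagram.mem_iff_lt_colLen.2 h1
  have h3 := YoungDiagram.mem_iff_lt_rowLen.1 h2
  rwa [rowLen_youngDiagram] at h3

/-- **The first-row inequality** (BLMW 2011 §8.1, after Brion; here from IMW point sets): if
`g(μ, ν, π) ≠ 0` then `μ₁ + ν₁ ≤ N + π₁` — equivalently `|π̄| ≤ |μ̄| + |ν̄|` for `π̄ = π` minus its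
first row. [cite: BurgisserEtAl2011, §8.1] -/
theorem getD_zero_add_le_of_kroneckerCoeff_ne_zero {mu nu pi : Nat.Partition N}
    (h : kroneckerCoeff ℂ mu nu pi ≠ 0) :
    mu.sortedParts.getD 0 0 + nu.sortedParts.getD 0 0 ≤ N + pi.sortedParts.getD 0 0 := by
  obtain ⟨P, hcard, hx, hy, -, hlt⟩ := exists_pointSet_cols_of_kroneckerCoeff_ne_zero h
  have := xMarginal_zero_add_yMarginal_zero_le P hlt
  rwa [hx 0, hy 0, hcard] at this

/-- **Discharge of `BLMW2011_kronecker_firstRow`** (BLMW 2011 §8.1: "if `k_{πμν} ≠ 0`, then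
`|π̄| ≤ |μ̄| + |ν̄|`"): from `μ₁ + ν₁ ≤ n + π₁`
(`getD_zero_add_le_of_kroneckerCoeff_ne_zero`) and `μ₁, ν₁, π₁ ≤ n`. [cite: BurgisserEtAl2011, §8.1] -/
theorem BLMW2011_kronecker_firstRow_holds : BLMW2011_kronecker_firstRow := by
  intro n π μ ν h
  have h1 := getD_zero_add_le_of_kroneckerCoeff_ne_zero h
  have hμ := getD_sortedParts_le μ 0
  have hν := getD_sortedParts_le ν 0
  have hπ := getD_sortedParts_le π 0
  rw [sup_parts_eq_getD_zero, sup_parts_eq_getD_zero, sup_parts_eq_getD_zero]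
  omega

/-- **Manivel's inequalities, general form** (BLMW 2011 §8.3 "Constraints", citing
[Manivel 1997, Théorème 3.2] for the rectangular case; here for arbitrary `μ, ν` and proved from
IMW point sets): if `g(μ, ν, π) ≠ 0` then for all `a, b`,
`|π|_{>ab} + |μ|_{≤a} + |ν|_{≤b} ≤ 2N`, i.e. `|π|_{>ab} ≤ |μ|_{>a} + |ν|_{>b}`
(`|π|_{>ab}` = the sum of the rows of `π` after the first `ab`, zero-padded rows). [cite: BurgisserEtAl2011, §8.3 (Constraints)] -/
theorem sum_drop_mul_le_of_kroneckerCoeff_ne_zero {mu nu pi : Nat.Partition N}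
    (h : kroneckerCoeff ℂ mu nu pi ≠ 0) (a b : ℕ) :
    (pi.sortedParts.drop (a * b)).sum + ∑ i ∈ Finset.range a, mu.sortedParts.getD i 0 +
        ∑ j ∈ Finset.range b, nu.sortedParts.getD j 0 ≤ N + N := by
  classical
  obtain ⟨P, hcard, hx, hy, hz, hlt⟩ := exists_pointSet_cols_of_kroneckerCoeff_ne_zero h
  have hltN : ∀ p ∈ P, p.2.2 < N := fun p hp =>
    lt_of_lt_of_le (hlt p hp) (getD_sortedParts_le pi 0)
  have h1 := sum_zMarginal_tsub_le P a b hltN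
  have h2 : ∑ l ∈ Finset.range N, (zMarginal P l - a * b) = (pi.sortedParts.drop (a * b)).sum := by
    rw [sum_drop_sortedParts_eq_sum_colLen_tsub]
    exact Finset.sum_congr rfl fun l _ => by rw [hz l]
  have h3 : (P.filter fun p => a ≤ p.1).card +
      ∑ i ∈ Finset.range a, mu.sortedParts.getD i 0 = N := by
    have e := Finset.card_filter_add_card_filter_not (s := P) (fun p : ℕ × ℕ × ℕ => a ≤ p.1)
    have e2 : (P.filter fun p : ℕ × ℕ × ℕ => ¬ a ≤ p.1) = P.filter fun p => p.1 < a :=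
      Finset.filter_congr fun p _ => not_le
    rw [e2, card_filter_fst_lt_eq_sum_xMarginal] at e
    simp_rw [hx] at e
    rwa [hcard] at e
  have h4 : (P.filter fun p => b ≤ p.2.1).card +
      ∑ j ∈ Finset.range b, nu.sortedParts.getD j 0 = N := by
    have e := Finset.card_filter_add_card_filter_not (s := P) (fun p : ℕ × ℕ × ℕ => b ≤ p.2.1)
    have e2 : (P.filter fun p : ℕ × ℕ × ℕ => ¬ b ≤ p.2.1) = P.filter fun p => p.2.1 < b :=
      Finset.filter_congr fun p _ => not_le
    rw [e2, card_filter_snd_lt_eq_sum_yMarginal] at e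
    simp_rw [hy] at e
    rwa [hcard] at e
  rw [h2] at h1
  omega

end Kronecker

/-! ### 4. BLMW 2011 §8.3 "Constraints" for `[(δⁿ)] ⊗ [(δⁿ)]` -/

section Rectangular

/-- **Constraint 1 (entropy)**: if `[π]` is a component of `[(δⁿ)] ⊗ [(δⁿ)]` then
`H(π̃) ≤ 2 log₂ n` — from (8.2.2) `H(π̃) ≤ H(μ̃) + H(ν̃)` (the tree's discharged
`ChristandlVranaZuiddam2023_entropy_le_of_kroneckerCoeff`) and `H ≤ log₂(#parts)`, the
rectangle having at most `n` parts. [cite: BurgisserEtAl2011, §8.3 (Constraints)] -/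
theorem partitionEntropy_le_of_kroneckerCoeff_rectangle_ne_zero (n δ : ℕ)
    (π : Nat.Partition (n * δ))
    (h : kroneckerCoeff ℂ (Nat.Partition.rectangle n δ) (Nat.Partition.rectangle n δ) π ≠ 0) :
    partitionEntropy π ≤ 2 * Real.logb 2 n := by
  have h1 := ChristandlVranaZuiddam2023_entropy_le_of_kroneckerCoeff_holds π
    (Nat.Partition.rectangle n δ) (Nat.Partition.rectangle n δ) h
  have h2 : partitionEntropy (Nat.Partition.rectangle n δ) ≤ Real.logb 2 n := by
    refine (partitionEntropy_le_log_card _).trans ?_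
    rw [← Real.log_div_log]
    refine div_le_div_of_nonneg_right ?_ (Real.log_pos one_lt_two).le
    have hc := Nat.Partition.card_parts_rectangle_le n δ
    rcases Nat.eq_zero_or_pos (Nat.Partition.rectangle n δ).parts.card with h0 | hpos
    · rw [h0, Nat.cast_zero, Real.log_zero]
      exact Real.log_natCast_nonneg n
    · exact Real.log_le_log (by exact_mod_cast hpos) (by exact_mod_cast hc)
  linarith

/-- **Constraint 2 (Manivel)**: if `[π]` is a component of `[(δⁿ)] ⊗ [(δⁿ)]` then for all
`a, b`, `|π|_{>ab} ≤ δ(n-a)⁺ + δ(n-b)⁺` — the case `μ = ν = δⁿ` of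
`sum_drop_mul_le_of_kroneckerCoeff_ne_zero` (`|δⁿ|_{≤a} = min(a,n) δ`).
[cite: BurgisserEtAl2011, §8.3 (Constraints)] -/
theorem sum_drop_mul_le_of_kroneckerCoeff_rectangle_ne_zero (n δ : ℕ)
    (π : Nat.Partition (n * δ))
    (h : kroneckerCoeff ℂ (Nat.Partition.rectangle n δ) (Nat.Partition.rectangle n δ) π ≠ 0)
    (a b : ℕ) : (π.sortedParts.drop (a * b)).sum ≤ δ * (n - a) + δ * (n - b) := by
  have h1 := sum_drop_mul_le_of_kroneckerCoeff_ne_zero h a b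
  rw [sum_range_getD_sortedParts_rectangle, sum_range_getD_sortedParts_rectangle] at h1
  have ha := mul_tsub_add_min_mul n δ a
  have hb := mul_tsub_add_min_mul n δ b
  omega

/-- **Constraint 3**: if `[π]` is a component of `[(δⁿ)] ⊗ [(δⁿ)]` and `n ≥ 1` then
`|π|_{≤n} ≥ δ` ("For example `|π|_{≤n} ≥ δ`": Constraint 2 with `a = 1`, `b = n` and
`|π| = nδ`). The hypothesis `n ≥ 1` is implicit in print (`n = dim V`); for `n = 0`, `δ ≥ 1` the
inequality fails (`π = ∅`). [cite: BurgisserEtAl2011, §8.3 (Constraints)] -/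
theorem le_sum_take_of_kroneckerCoeff_rectangle_ne_zero (n δ : ℕ) (hn : 0 < n)
    (π : Nat.Partition (n * δ))
    (h : kroneckerCoeff ℂ (Nat.Partition.rectangle n δ) (Nat.Partition.rectangle n δ) π ≠ 0) :
    δ ≤ (π.sortedParts.take n).sum := by
  have h2 := sum_drop_mul_le_of_kroneckerCoeff_rectangle_ne_zero n δ π h 1 n
  have htot : (π.sortedParts.take n).sum + (π.sortedParts.drop n).sum = n * δ := by
    rw [List.sum_take_add_sum_drop, Nat.Partition.sum_sortedParts]
  rw [one_mul, Nat.sub_self, mul_zero, add_zero] at h2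
  obtain ⟨m, rfl⟩ := Nat.exists_eq_succ_of_ne_zero hn.ne'
  rw [Nat.succ_sub_one] at h2
  have e2 : m.succ * δ = m * δ + δ := Nat.succ_mul m δ
  have e : δ * m = m * δ := mul_comm _ _
  omega

/-- **BLMW 2011 §8.3 "Constraints", all three, for `n ≥ 1`** — the statement of the named fact
`BLMW2011_rectangular_constraints` with the printed (implicit) hypothesis `0 < n` inserted before
the Kronecker hypothesis; with that hypothesis carried by the fact, this theorem is its
discharge. [cite: BurgisserEtAl2011, §8.3 (Constraints)] -/
theorem BLMW2011_rectangular_constraints_of_pos :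
    ∀ (n δ : ℕ) (π : Nat.Partition (n * δ)), 0 < n →
      kroneckerCoeff ℂ (Nat.Partition.rectangle n δ) (Nat.Partition.rectangle n δ) π ≠ 0 →
        partitionEntropy π ≤ 2 * Real.logb 2 n ∧
        (∀ a b : ℕ, (π.sortedParts.drop (a * b)).sum ≤ δ * (n - a) + δ * (n - b)) ∧
        δ ≤ (π.sortedParts.take n).sum :=
  fun n δ π hn h =>
    ⟨partitionEntropy_le_of_kroneckerCoeff_rectangle_ne_zero n δ π h,
      sum_drop_mul_le_of_kroneckerCoeff_rectangle_ne_zero n δ π h,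
      le_sum_take_of_kroneckerCoeff_rectangle_ne_zero n δ hn π h⟩

/-- **Discharge of `BLMW2011_rectangular_constraints`** (BLMW 2011 §8.3 "Constraints", for
`n ≥ 1` as the fact now carries): it is `BLMW2011_rectangular_constraints_of_pos`.
[cite: BurgisserEtAl2011, §8.3 (Constraints)] -/
theorem BLMW2011_rectangular_constraints_holds : BLMW2011_rectangular_constraints :=
  BLMW2011_rectangular_constraints_of_pos

end Rectangular

end Literature.Computability.AlgebraicComplexity
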